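import Literature.Geometry.Symplectic.GirouxContactPathFlat
import HarnessLib

/-!
# Giroux's path of contact forms, III: the sign analysis on the flat models

Topic `Literature/Geometry/Symplectic`.  Third file of the proof of
`Literature.Geometry.Symplectic.GirouxContactPath` (Etnyre 2006, Prop. 3.5/3.18 with the proof of
Lemma 3.3).  With `W(α) = α ∧ dα` and, for the auxiliary form `β = f(r) dθ`,
`L(α) = α ∧ dβ + β ∧ dα`, the printed proof computes

`(α + Rβ) ∧ d(α + Rβ) = W(α) + R L(α) + R² β ∧ dβ`, `β ∧ dβ = 0`,

and argues that `L(α)` is a POSITIVE multiple of the orientation wherever `α` is a Giroux form: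
off the binding because `dθ ∧ dα > 0` on the pages (`dα` is a positive area form on the pages)
and `α ∧ dr ∧ dθ ≥ 0` (`α(∂_ψ) > 0` near the binding), on the binding because
`f'(r) α ∧ dr ∧ dθ = 2 α(∂_ψ) dx ∧ dy > 0`.  Hence for `R` large `s α_{1R} + (1 - s) α_{0R}` is
contact.  This file proves exactly these statements, pointwise on the flat models of
`GirouxContactPathFlat.lean` and then uniformly on compact sets:

* `PosTogether W L` — "`L` has the sign of `W`" (both positive on one frame, hence on the same
  frames, `GirouxContactPathAlgebra.lean`), `Lform a da b db = a ∧ db + b ∧ da`;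
* `posTogether_chartModel` — the region where `β = c dθ` (`dβ = 0`, `dθ ≠ 0`): `L = c dθ ∧ dα`
  is positive on the adapted frame;
* `posTogether_tubeModel` — the tube region where `β = κ(r²) (x dy - y dx)`: on the frame
  `(∂_θ, ∂_ψ, ∂_r)` (`eθ, e₀, er`) one has `L = 2ρχ'(ρ) α(∂_ψ) + κ(ρ) ρ dα(∂_ψ, ∂_r)` with
  `χ(ρ) = ρ κ(ρ)` nondecreasing, and on the binding `L = 2κ(0) α(∂_ψ)` on `(e₀, e₁, e₂)`;
* `wedge_add_smul_ne_zero` — the endpoint segments: `W(α + R'β) ≠ 0` for every `R' ≥ 0`;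
* `exists_R_of_isCompact` — **the choice of `R`**: on a compact set of parameters, if `L(α₀)`,
  `L(α₁)` have the signs of `W(α₀)`, `W(α₁)` and these agree, then for all `R ≥ R₀`,
  `s ∈ [0, 1]`: `W((1 - s)α₀ + sα₁ + Rβ) ≠ 0` (`|quadratic part| ≤ C < R c ≤ R |L|`).

Everything is proved; `PosTogether`, `Lform`, `erVec`, `eθVec` are the only definitions.

## References

* J. B. Etnyre, *Lectures on open book decompositions and contact structures* (2006), proof of
  Lemma 3.3 and of Prop. 3.5 (arXiv) = 3.18 (Clay volume). [Etnyre2006]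
-/

noncomputable section

open scoped Manifold ContDiff Topology
open Set Function
open Literature.Geometry.Kaehler

namespace Literature.Geometry.Symplectic

/-- Local notation: `𝔼 n` is the model Euclidean space `EuclideanSpace ℝ (Fin n)`. -/
local notation "𝔼 " n:arg => EuclideanSpace ℝ (Fin n)

/-- Swapping two vectors of the frame changes the sign of a continuous alternating map
(`AlternatingMap.map_swap` through the coercion). [folklore] -/
theorem cam_map_swap {ι : Type*} [DecidableEq ι] {M N : Type*} [AddCommGroup M] [Module ℝ M]
    [TopologicalSpace M] [AddCommGroup N] [Module ℝ N] [TopologicalSpace N]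
    (f : M [⋀^ι]→L[ℝ] N) (v : ι → M) {i j : ι} (hij : i ≠ j) :
    f (v ∘ Equiv.swap i j) = -f v :=
  f.toAlternatingMap.map_swap v hij

/-! ### `PosTogether`: two top forms of the same sign -/

section PosTogether

/-- **`L` has the sign of `W`**: the alternating `3`-forms `W` and `L` on `ℝ³` are both positive on
some common frame (hence, both being multiples of the determinant, `L` is a positive multiple of
`W`; `alt3_pos_iff_pos_of_pos`). [folklore] -/
def PosTogether (W L : (𝔼 3) [⋀^Fin 3]→L[ℝ] ℝ) : Prop :=
  ∃ t : Fin 3 → 𝔼 3, 0 < W t ∧ 0 < L t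

variable {W L : (𝔼 3) [⋀^Fin 3]→L[ℝ] ℝ}

/-- Forms of the same sign are positive on the same frames. [folklore] -/
theorem PosTogether.pos_iff (h : PosTogether W L) (t : Fin 3 → 𝔼 3) : 0 < W t ↔ 0 < L t := by
  obtain ⟨t₀, h₁, h₂⟩ := h
  exact alt3_pos_iff_pos_of_pos h₁ h₂ t

/-- Forms of the same sign are negative on the same frames. [folklore] -/
theorem PosTogether.neg_iff (h : PosTogether W L) (t : Fin 3 → 𝔼 3) : W t < 0 ↔ L t < 0 := by
  obtain ⟨t₀, h₁, h₂⟩ := h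
  exact alt3_neg_iff_neg_of_pos h₁ h₂ t

/-- **Same strict sign on one frame suffices**: if `W t · L t > 0` then `L` has the sign of `W`
(if both are negative, swap two vectors of the frame). [folklore] -/
theorem posTogether_of_mul_pos {t : Fin 3 → 𝔼 3} (h : 0 < W t * L t) : PosTogether W L := by
  rcases lt_or_gt_of_ne (show W t ≠ 0 from fun h0 => by simp [h0] at h) with hW | hW
  · have hL : L t < 0 := by
      by_contra hL; push Not at hL; nlinarith
    refine ⟨t ∘ Equiv.swap (0 : Fin 3) 1, ?_, ?_⟩
    · rw [cam_map_swap W t (show (0 : Fin 3) ≠ 1 by decide)]; linarith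
    · rw [cam_map_swap L t (show (0 : Fin 3) ≠ 1 by decide)]; linarith
  · have hL : 0 < L t := by
      by_contra hL; push Not at hL; nlinarith
    exact ⟨t, hW, hL⟩

/-- A form with the sign of a nonvanishing-somewhere form... : `W` in a `PosTogether` pair is
nonzero on the standard frame. [folklore] -/
theorem PosTogether.apply_std_ne_zero (h : PosTogether W L) :
    W ![stdBasis3 0, stdBasis3 1, stdBasis3 2] ≠ 0 := by
  obtain ⟨t₀, h₁, -⟩ := h
  exact alt3_apply_std_ne_zero (ne_of_gt h₁)

/-- **`L(α) = α ∧ dβ + β ∧ dα`**, the part of `(α + Rβ) ∧ d(α + Rβ)` linear in `R`, as an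
alternating `3`-form. [cite: Etnyre2006, proof of Lemma 3.3] -/
def Lform (a : (𝔼 3) [⋀^Fin 1]→L[ℝ] ℝ) (da : (𝔼 3) [⋀^Fin 2]→L[ℝ] ℝ)
    (b : (𝔼 3) [⋀^Fin 1]→L[ℝ] ℝ) (db : (𝔼 3) [⋀^Fin 2]→L[ℝ] ℝ) : (𝔼 3) [⋀^Fin 3]→L[ℝ] ℝ :=
  wedgeForm a db + wedgeForm b da

/-- `Lform a da b db (u, v, w) = (a ∧ db)(u, v, w) + (b ∧ da)(u, v, w)`. [folklore] -/
@[simp] theorem Lform_apply (a : (𝔼 3) [⋀^Fin 1]→L[ℝ] ℝ) (da : (𝔼 3) [⋀^Fin 2]→L[ℝ] ℝ)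
    (b : (𝔼 3) [⋀^Fin 1]→L[ℝ] ℝ) (db : (𝔼 3) [⋀^Fin 2]→L[ℝ] ℝ) (u v w : 𝔼 3) :
    Lform a da b db ![u, v, w] = wedge₁₂ a db u v w + wedge₁₂ b da u v w := by
  simp [Lform]

/-- **The expansion `(a + Rb) ∧ (da + R db) = a ∧ da + R (a ∧ db + b ∧ da) + R² b ∧ db`.**
[cite: Etnyre2006, proof of Lemma 3.3] -/
theorem wedge₁₂_add_smul_expand (a b : (𝔼 3) [⋀^Fin 1]→L[ℝ] ℝ) (da db : (𝔼 3) [⋀^Fin 2]→L[ℝ] ℝ)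
    (R : ℝ) (u v w : 𝔼 3) :
    wedge₁₂ (a + R • b) (da + R • db) u v w =
      wedge₁₂ a da u v w + R * (wedge₁₂ a db u v w + wedge₁₂ b da u v w) +
        R ^ 2 * wedge₁₂ b db u v w := by
  simp only [wedge₁₂_add_left, wedge₁₂_add_right, wedge₁₂_smul_left, wedge₁₂_smul_right]
  ring

end PosTogether

/-! ### The endpoint segments: `W(α + R'β) ≠ 0` for `R' ≥ 0` -/

section Endpoint

/-- **`(α + R'β) ∧ d(α + R'β) ≠ 0` for all `R' ≥ 0`** when `L(α)` has the sign of `W(α)` and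
`β ∧ dβ = 0` (Etnyre: "`α_R` is a contact form for all `R > 0`": the three terms have the same
sign). Stated on the standard frame. [cite: Etnyre2006, proof of Lemma 3.3] -/
theorem wedge_add_smul_ne_zero {a b : (𝔼 3) [⋀^Fin 1]→L[ℝ] ℝ} {da db : (𝔼 3) [⋀^Fin 2]→L[ℝ] ℝ}
    (hA : PosTogether (wedgeForm a da) (Lform a da b db)) (hbb : ∀ t, wedgeForm b db t = 0)
    {R : ℝ} (hR : 0 ≤ R) :
    wedge₁₂ (a + R • b) (da + R • db) (stdBasis3 0) (stdBasis3 1) (stdBasis3 2) ≠ 0 := by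
  set e : Fin 3 → 𝔼 3 := ![stdBasis3 0, stdBasis3 1, stdBasis3 2] with he
  have hW : wedgeForm a da e ≠ 0 := hA.apply_std_ne_zero
  have hbb' : wedge₁₂ b db (stdBasis3 0) (stdBasis3 1) (stdBasis3 2) = 0 := by
    rw [← wedgeForm_apply]; exact hbb e
  rw [wedge₁₂_add_smul_expand, hbb', mul_zero, add_zero, ← Lform_apply, ← wedgeForm_apply, ← he]
  rcases lt_or_gt_of_ne hW with hneg | hpos
  · have hL : Lform a da b db e < 0 := (hA.neg_iff e).1 hneg
    nlinarith
  · have hL : 0 < Lform a da b db e := (hA.pos_iff e).1 hpos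
    nlinarith

end Endpoint

/-! ### The chart model: `β = c dθ` with `dβ = 0` -/

section ChartModel

/-- A `1`-form on `ℝ³` is zero iff its covector is. [folklore] -/
theorem covector_ne_zero {th : (𝔼 3) [⋀^Fin 1]→L[ℝ] ℝ} (h : th ≠ 0) : covector th ≠ 0 := by
  intro h0
  apply h
  have : th = ContinuousAlternatingMap.ofSubsingleton ℝ (𝔼 3) ℝ (0 : Fin 1) (covector th) :=
    ((ContinuousAlternatingMap.ofSubsingleton ℝ (𝔼 3) ℝ (0 : Fin 1)).apply_symm_apply th).symm
  rw [this, h0]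
  ext v
  simp

/-- **The region `β = c dθ`, `c > 0`** (`dβ = 0`; Etnyre's region "where `f` is `1`"): if the
covector `th = dθ` is nonzero, `W(α) = α ∧ dα ≠ 0` (contact) and `dα > 0` on the positively
oriented pages (`th(n) > 0`, `th(u) = th(v) = 0`, `W(α)(n, u, v) > 0 ⇒ dα(u, v) > 0`), then
`L(α) = c dθ ∧ dα` has the sign of `W(α)`: on the adapted frame
`L(n, u, v) = c · th(n) · dα(u, v) > 0`. [cite: Etnyre2006, proof of Lemma 3.3] -/
theorem posTogether_chartModel {a th : (𝔼 3) [⋀^Fin 1]→L[ℝ] ℝ} {da : (𝔼 3) [⋀^Fin 2]→L[ℝ] ℝ}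
    {c : ℝ} (hc : 0 < c) (hth : th ≠ 0) {t₀ : Fin 3 → 𝔼 3} (hW : wedgeForm a da t₀ ≠ 0)
    (hpages : ∀ n u v : 𝔼 3, 0 < th ![n] → th ![u] = 0 → th ![v] = 0 →
      0 < wedge₁₂ a da n u v → 0 < da ![u, v]) :
    PosTogether (wedgeForm a da) (Lform a da (c • th) 0) := by
  obtain ⟨n, u, v, hn, hu, hv, hWt⟩ := exists_adapted_triple (covector th) (covector_ne_zero hth) hW
  rw [covector_apply] at hn hu hv
  rw [wedgeForm_apply] at hWt
  have hda : 0 < da ![u, v] := hpages n u v hn hu hv hWt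
  refine ⟨![n, u, v], by rwa [wedgeForm_apply], ?_⟩
  rw [Lform_apply, wedge₁₂_zero_right, zero_add, wedge₁₂_smul_left]
  simp only [wedge₁₂, hu, hv, zero_mul, sub_zero, add_zero]
  exact mul_pos hc (mul_pos hn hda)

end ChartModel

/-! ### The tube model: `β = κ(r²) (x dy - y dx)` -/

section TubeModel

/-- The radial vector `∂_r`-direction `er = x e₁ + y e₂` at `p = (ψ, x, y)` (unnormalised:
length `r`). [folklore] -/
def erVec (p : 𝔼 3) : 𝔼 3 := p 1 • stdBasis3 1 + p 2 • stdBasis3 2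

/-- The angular vector `∂_θ`-direction `eθ = -y e₁ + x e₂` at `p = (ψ, x, y)` (unnormalised:
`r ∂/∂r`-rotated, length `r`; `dθ(eθ) = 1 · r²/r² > 0`). [folklore] -/
def eθVec (p : 𝔼 3) : 𝔼 3 := (-p 2) • stdBasis3 1 + p 1 • stdBasis3 2

/-- Coordinates of the standard basis vectors. [folklore] -/
@[simp] theorem stdBasis3_coord (i j : Fin 3) :
    (stdBasis3 j : 𝔼 3) i = if i = j then 1 else 0 := by
  rw [stdBasis3_apply]
  exact PiLp.single_apply _ _ _ _ _

/-- Coordinates of `erVec p = (0, x, y)`. [folklore] -/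
@[simp] theorem erVec_coord (p : 𝔼 3) (i : Fin 3) :
    erVec p i = if i = 1 then p 1 else if i = 2 then p 2 else 0 := by
  fin_cases i <;> simp [erVec]

/-- Coordinates of `eθVec p = (0, -y, x)`. [folklore] -/
@[simp] theorem eθVec_coord (p : 𝔼 3) (i : Fin 3) :
    eθVec p i = if i = 1 then -p 2 else if i = 2 then p 1 else 0 := by
  fin_cases i <;> simp [eθVec]

/-- The determinant of a frame with respect to the standard basis is the `3 × 3` determinant of
its coordinates. [folklore] -/
theorem stdBasis3_det_apply (t : Fin 3 → 𝔼 3) :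
    stdBasis3.det t =
      t 0 0 * t 1 1 * t 2 2 - t 0 0 * t 2 1 * t 1 2 - t 1 0 * t 0 1 * t 2 2 +
        t 1 0 * t 2 1 * t 0 2 + t 2 0 * t 0 1 * t 1 2 - t 2 0 * t 1 1 * t 0 2 := by
  rw [Module.Basis.det_apply, Matrix.det_fin_three]
  have h : ∀ i j, stdBasis3.toMatrix t i j = t j i := fun i j => by
    rw [Module.Basis.toMatrix_apply, stdBasis3, OrthonormalBasis.coe_toBasis_repr_apply,
      EuclideanSpace.basisFun_repr]
  simp only [h]

/-- **The frame `(eθ, e₀, er)` has determinant `r² = rho p`** (it is positively oriented with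
respect to `(e₀, e₁, e₂)` off the binding). [folklore] -/
theorem det_tubeFrame (p : 𝔼 3) : stdBasis3.det ![eθVec p, stdBasis3 0, erVec p] = rho p := by
  rw [stdBasis3_det_apply]
  simp [rho]
  ring

/-- The standard frame has determinant `1`. [folklore] -/
theorem det_stdFrame : stdBasis3.det ![stdBasis3 0, stdBasis3 1, stdBasis3 2] = 1 := by
  rw [← coe_stdBasis3_eq, Module.Basis.det_self]

variable {κ : ℝ → ℝ}

/-- Values of `lam = x dy - y dx` on the tube frame: `lam(eθ) = ρ`, `lam(e₀) = 0`, `lam(er) = 0`.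
[folklore] -/
theorem lamF_tubeFrame (p : 𝔼 3) :
    lamF p ![eθVec p] = rho p ∧ lamF p ![stdBasis3 0] = 0 ∧ lamF p ![erVec p] = 0 := by
  refine ⟨?_, ?_, ?_⟩
  · simp [rho]; ring
  · simp
  · simp; ring

/-- `bflatF κ p = κ(ρ) • lam p`, evaluated. [folklore] -/
theorem bflatF_apply_eq (κ : ℝ → ℝ) (p : 𝔼 3) (v : Fin 1 → 𝔼 3) :
    bflatF κ p v = κ (rho p) * lamF p v :=
  ContinuousAlternatingMap.smul_apply _ _ _

/-- Values of the model form on the tube frame: `β(eθ) = κ(ρ) ρ`, `β(e₀) = 0`, `β(er) = 0`.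
[folklore] -/
theorem bflatF_tubeFrame (κ : ℝ → ℝ) (p : 𝔼 3) :
    bflatF κ p ![eθVec p] = κ (rho p) * rho p ∧ bflatF κ p ![stdBasis3 0] = 0 ∧
      bflatF κ p ![erVec p] = 0 := by
  obtain ⟨h1, h2, h3⟩ := lamF_tubeFrame p
  rw [bflatF_apply_eq, bflatF_apply_eq, bflatF_apply_eq, h1, h2, h3, mul_zero]
  exact ⟨rfl, rfl, rfl⟩

/-- Values of `dβ` on the tube frame: `dβ(e₀, er) = 0`, `dβ(eθ, er) = -2ρ (κ(ρ) + ρ κ'(ρ))`,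
`dβ(eθ, e₀) = 0`. [folklore] -/
theorem extDeriv_bflatF_tubeFrame (hκ : ContDiff ℝ ∞ κ) (p : 𝔼 3) :
    extDeriv (bflatF κ) p ![stdBasis3 0, erVec p] = 0 ∧
      extDeriv (bflatF κ) p ![eθVec p, erVec p] =
        -(2 * rho p * (κ (rho p) + rho p * deriv κ (rho p))) ∧
      extDeriv (bflatF κ) p ![eθVec p, stdBasis3 0] = 0 := by
  refine ⟨?_, ?_, ?_⟩
  · rw [extDeriv_bflatF_apply hκ]; simp
  · rw [extDeriv_bflatF_apply hκ]; simp [rho]; ring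
  · rw [extDeriv_bflatF_apply hκ]; simp

/-- **`L(α)` on the tube frame**: `L(eθ, e₀, er) = 2ρ (κ(ρ) + ρκ'(ρ)) α(e₀) + κ(ρ) ρ dα(e₀, er)`
(Etnyre's `R f dθ ∧ dα + R f' α ∧ dr ∧ dθ` evaluated on `(∂_θ, ∂_ψ, ∂_r)`). [cite: Etnyre2006, proof of Lemma 3.3] -/
theorem Lform_tubeFrame (hκ : ContDiff ℝ ∞ κ) (a : (𝔼 3) [⋀^Fin 1]→L[ℝ] ℝ)
    (da : (𝔼 3) [⋀^Fin 2]→L[ℝ] ℝ) (p : 𝔼 3) :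
    Lform a da (bflatF κ p) (extDeriv (bflatF κ) p) ![eθVec p, stdBasis3 0, erVec p] =
      2 * rho p * (κ (rho p) + rho p * deriv κ (rho p)) * a ![stdBasis3 0] +
        κ (rho p) * rho p * da ![stdBasis3 0, erVec p] := by
  obtain ⟨h1, h2, h3⟩ := extDeriv_bflatF_tubeFrame hκ p
  obtain ⟨h4, h5, h6⟩ := bflatF_tubeFrame κ p
  rw [Lform_apply, wedge₁₂, wedge₁₂, h1, h2, h3, h4, h5, h6]
  ring

/-- **`L(α)` on the binding**: at `x = y = 0`, `L(e₀, e₁, e₂) = 2 κ(0) α(e₀)` (Etnyre's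
`f' α ∧ dr ∧ dθ = 2 α(∂_ψ) dx ∧ dy` at `r = 0`, where `β = 0` and `dβ = 2κ(0) dx ∧ dy`).
[cite: Etnyre2006, proof of Lemma 3.3] -/
theorem Lform_stdFrame_of_rho_eq_zero (hκ : ContDiff ℝ ∞ κ) (a : (𝔼 3) [⋀^Fin 1]→L[ℝ] ℝ)
    (da : (𝔼 3) [⋀^Fin 2]→L[ℝ] ℝ) {p : 𝔼 3} (hp : rho p = 0) :
    Lform a da (bflatF κ p) (extDeriv (bflatF κ) p) ![stdBasis3 0, stdBasis3 1, stdBasis3 2] =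
      2 * κ 0 * a ![stdBasis3 0] := by
  obtain ⟨hp1, hp2⟩ := (rho_eq_zero_iff p).1 hp
  rw [Lform_apply, wedge₁₂, wedge₁₂, extDeriv_bflatF_apply hκ, extDeriv_bflatF_apply hκ,
    extDeriv_bflatF_apply hκ]
  simp [hp, hp1, hp2]
  ring

/-- **The tube region** (Etnyre's regions "near the binding where `f(r) = r²`" and "where `f`
is not `1`"): let `β = κ(r²)(x dy - y dx)` with `κ > 0` and `χ(ρ) = ρκ(ρ)` nondecreasing
(`κ + ρκ' ≥ 0`). If at the point `p` the form `α` satisfies the (transported) Giroux conditions —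
`α(e₀) · W(α)(e₀, e₁, e₂) > 0` (binding positively transverse, valid on the whole thin tube)
and, off the binding, `dα > 0` on positively oriented frames of the pages `{θ = const}`
(`lam(n) > 0`, `lam(u) = lam(v) = 0`, `W(α)(n,u,v) > 0 ⇒ dα(u,v) > 0`) — then
`L(α) = α ∧ dβ + β ∧ dα` has the sign of `W(α) = α ∧ dα`. [cite: Etnyre2006, proof of Lemma 3.3 and Prop. 3.5] -/
theorem posTogether_tubeModel (hκ : ContDiff ℝ ∞ κ) (hκpos : ∀ r, 0 ≤ r → 0 < κ r)
    (hκmono : ∀ r, 0 ≤ r → 0 ≤ κ r + r * deriv κ r)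
    {a : (𝔼 3) [⋀^Fin 1]→L[ℝ] ℝ} {da : (𝔼 3) [⋀^Fin 2]→L[ℝ] ℝ} {p : 𝔼 3}
    (hbind : 0 < a ![stdBasis3 0] * wedge₁₂ a da (stdBasis3 0) (stdBasis3 1) (stdBasis3 2))
    (hpages : 0 < rho p → ∀ n u v : 𝔼 3, 0 < lamF p ![n] → lamF p ![u] = 0 → lamF p ![v] = 0 →
      0 < wedge₁₂ a da n u v → 0 < da ![u, v]) :
    PosTogether (wedgeForm a da) (Lform a da (bflatF κ p) (extDeriv (bflatF κ) p)) := by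
  set W := wedgeForm a da with hWdef
  set e : Fin 3 → 𝔼 3 := ![stdBasis3 0, stdBasis3 1, stdBasis3 2] with he
  have hWe : W e = wedge₁₂ a da (stdBasis3 0) (stdBasis3 1) (stdBasis3 2) := wedgeForm_apply _ _ _ _ _
  rcases eq_or_lt_of_le (rho_nonneg p) with h0 | hρ
  · -- on the binding: `L(e) = 2κ(0) a(e₀)` has the sign of `a(e₀)`, i.e. of `W(e)`
    apply posTogether_of_mul_pos (t := e)
    rw [Lform_stdFrame_of_rho_eq_zero hκ a da h0.symm, hWe]
    have hk : 0 < κ 0 := hκpos 0 le_rfl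
    nlinarith [mul_pos hk hbind]
  · -- off the binding: the frame `t = (eθ, e₀, er)`, `det t = ρ > 0`
    set t : Fin 3 → 𝔼 3 := ![eθVec p, stdBasis3 0, erVec p] with ht
    have hdet_e : stdBasis3.det e = 1 := by rw [he]; exact det_stdFrame
    have hWt : W t = W e * rho p := by
      rw [alt3_apply_eq_mul_det W t, alt3_apply_eq_mul_det W e, det_tubeFrame, hdet_e, mul_one]
    have hWe0 : W e ≠ 0 := by
      intro h; rw [hWe] at h; rw [h, mul_zero] at hbind; exact lt_irrefl _ hbind
    have hlam : 0 < lamF p ![eθVec p] ∧ lamF p ![stdBasis3 0] = 0 ∧ lamF p ![erVec p] = 0 := by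
      obtain ⟨h1, h2, h3⟩ := lamF_tubeFrame p
      exact ⟨h1 ▸ hρ, h2, h3⟩
    have hL := Lform_tubeFrame hκ a da p
    have hχ : 0 ≤ κ (rho p) + rho p * deriv κ (rho p) := hκmono _ hρ.le
    have hk : 0 < κ (rho p) := hκpos _ hρ.le
    rcases lt_or_gt_of_ne hWe0 with hneg | hpos
    · -- `W(e) < 0`: `a(e₀) < 0`, `W(t) < 0`; use the frame `t' = (eθ, er, e₀)`
      have ha : a ![stdBasis3 0] < 0 := by
        rw [hWe] at hneg
        by_contra h; push Not at h
        nlinarith [mul_nonpos_of_nonneg_of_nonpos h hneg.le]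
      have hWt' : W t < 0 := by rw [hWt]; exact mul_neg_of_neg_of_pos hneg hρ
      set t' : Fin 3 → 𝔼 3 := ![eθVec p, erVec p, stdBasis3 0] with ht'
      have htt' : t' = t ∘ Equiv.swap (1 : Fin 3) 2 := by
        funext i; fin_cases i <;> rfl
      have hWt'pos : 0 < W t' := by
        rw [htt', cam_map_swap W t (show (1 : Fin 3) ≠ 2 by decide)]; linarith
      have hda : 0 < da ![erVec p, stdBasis3 0] := by
        refine hpages hρ (eθVec p) (erVec p) (stdBasis3 0) hlam.1 hlam.2.2 hlam.2.1 ?_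
        rw [← wedgeForm_apply]; exact hWt'pos
      have hda' : da ![stdBasis3 0, erVec p] = -da ![erVec p, stdBasis3 0] := by
        have h := cam_map_swap da ![erVec p, stdBasis3 0] (show (0 : Fin 2) ≠ 1 by decide)
        have e2 : (![erVec p, stdBasis3 0] : Fin 2 → 𝔼 3) ∘ Equiv.swap (0 : Fin 2) 1 =
            ![stdBasis3 0, erVec p] := by
          funext i; fin_cases i <;> rfl
        rw [e2] at h
        exact h
      refine ⟨t', hWt'pos, ?_⟩
      rw [htt', cam_map_swap (Lform a da _ _) t (show (1 : Fin 3) ≠ 2 by decide), hL, hda']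
      have h1 : 0 ≤ 2 * rho p * (κ (rho p) + rho p * deriv κ (rho p)) * (-a ![stdBasis3 0]) :=
        mul_nonneg (mul_nonneg (by positivity) hχ) (by linarith)
      have h2 : 0 < κ (rho p) * rho p * da ![erVec p, stdBasis3 0] := mul_pos (mul_pos hk hρ) hda
      nlinarith
    · -- `W(e) > 0`: `a(e₀) > 0`, `W(t) > 0`; use the frame `t`
      have ha : 0 < a ![stdBasis3 0] := by
        rw [hWe] at hpos
        by_contra h; push Not at h
        nlinarith [mul_nonpos_of_nonpos_of_nonneg h hpos.le]
      have hWtpos : 0 < W t := by rw [hWt]; exact mul_pos hpos hρ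
      have hda : 0 < da ![stdBasis3 0, erVec p] := by
        refine hpages hρ (eθVec p) (stdBasis3 0) (erVec p) hlam.1 hlam.2.1 hlam.2.2 ?_
        rw [← wedgeForm_apply]; exact hWtpos
      refine ⟨t, hWtpos, ?_⟩
      rw [hL]
      have h1 : 0 ≤ 2 * rho p * (κ (rho p) + rho p * deriv κ (rho p)) * a ![stdBasis3 0] :=
        mul_nonneg (mul_nonneg (by positivity) hχ) ha.le
      have h2 : 0 < κ (rho p) * rho p * da ![stdBasis3 0, erVec p] := mul_pos (mul_pos hk hρ) hda
      linarith

/-- **`β ∧ dβ = 0` for the model form** `β = κ(r²)(x dy - y dx)` (both factors only see the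
`(x, y)`-components: a `3`-form pulled back from the plane). [cite: Etnyre2006, proof of Lemma 3.3] -/
theorem wedgeForm_bflatF_self (hκ : ContDiff ℝ ∞ κ) (p : 𝔼 3) (t : Fin 3 → 𝔼 3) :
    wedgeForm (bflatF κ p) (extDeriv (bflatF κ) p) t = 0 := by
  have ht : t = ![t 0, t 1, t 2] := by funext i; fin_cases i <;> rfl
  rw [ht, wedgeForm_apply, wedge₁₂, extDeriv_bflatF_apply hκ, extDeriv_bflatF_apply hκ,
    extDeriv_bflatF_apply hκ]
  simp
  ring

end TubeModel

/-! ### The choice of `R` on a compact set of parameters -/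

section Compact

/-- **`x ↦ wedge₁₂ (f x) (g x) u v w` is continuous on `s`** if `f`, `g` are (a polynomial in
evaluations of `f x`, `g x` at fixed vectors). [folklore] -/
theorem continuousOn_wedge₁₂ {X : Type*} [TopologicalSpace X] {s : Set X}
    {f : X → (𝔼 3) [⋀^Fin 1]→L[ℝ] ℝ} {g : X → (𝔼 3) [⋀^Fin 2]→L[ℝ] ℝ}
    (hf : ContinuousOn f s) (hg : ContinuousOn g s) (u v w : 𝔼 3) :
    ContinuousOn (fun x => wedge₁₂ (f x) (g x) u v w) s := by
  have h1 : ∀ y : Fin 1 → 𝔼 3, ContinuousOn (fun x => f x y) s := fun y =>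
    (continuous_eval_const y).comp_continuousOn hf
  have h2 : ∀ y : Fin 2 → 𝔼 3, ContinuousOn (fun x => g x y) s := fun y =>
    (continuous_eval_const y).comp_continuousOn hg
  unfold wedge₁₂
  exact (((h1 _).mul (h2 _)).sub ((h1 _).mul (h2 _))).add ((h1 _).mul (h2 _))

/-- **Real-analysis core of the choice of `R`**: on a compact set, if `ℓ` is continuous and
nowhere zero and `q` is continuous, then `q + R ℓ ≠ 0` for all `R ≥ R₀ := C/c + 1`
(`|q| ≤ C`, `|ℓ| ≥ c > 0`). [folklore] -/
theorem exists_R_of_continuousOn {X : Type*} [TopologicalSpace X] {S : Set X} (hS : IsCompact S)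
    {q ℓ : X → ℝ} (hq : ContinuousOn q S) (hℓ : ContinuousOn ℓ S) (hne : ∀ z ∈ S, ℓ z ≠ 0) :
    ∃ R₀ : ℝ, 0 < R₀ ∧ ∀ R, R₀ ≤ R → ∀ z ∈ S, q z + R * ℓ z ≠ 0 := by
  rcases S.eq_empty_or_nonempty with hSe | hSne
  · exact ⟨1, one_pos, fun R _ z hz => by rw [hSe] at hz; exact absurd hz (notMem_empty _)⟩
  obtain ⟨zm, hzmS, hzm⟩ := hS.exists_isMinOn hSne (continuous_abs.comp_continuousOn hℓ)
  obtain ⟨zM, hzMS, hzM⟩ := hS.exists_isMaxOn hSne (continuous_abs.comp_continuousOn hq)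
  set c := |ℓ zm| with hc
  set C := |q zM| with hC
  have hcpos : 0 < c := abs_pos.2 (hne zm hzmS)
  refine ⟨C / c + 1, by positivity, fun R hR z hz h0 => ?_⟩
  have h1 : c ≤ |ℓ z| := hzm hz
  have h2 : |q z| ≤ C := hzM hz
  have hR0 : 0 < R := lt_of_lt_of_le (by positivity) hR
  have h3 : R * c ≤ |R * ℓ z| := by
    rw [abs_mul, abs_of_pos hR0]
    exact mul_le_mul_of_nonneg_left h1 hR0.le
  have h4 : C < R * c := by
    have : (C / c + 1) * c ≤ R * c := mul_le_mul_of_nonneg_right hR hcpos.le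
    have h5 : (C / c + 1) * c = C + c := by field_simp
    linarith
  have h6 : |R * ℓ z| = |q z| := by
    have : R * ℓ z = -q z := by linarith
    rw [this, abs_neg]
  linarith

/-- The quadratic part `W((1-s)a₀ + sa₁)` on the standard frame, as a function of `(s, p)`.
[cite: Etnyre2006, proof of Prop. 3.5] -/
def qPart (a₀ a₁ : 𝔼 3 → (𝔼 3) [⋀^Fin 1]→L[ℝ] ℝ) (da₀ da₁ : 𝔼 3 → (𝔼 3) [⋀^Fin 2]→L[ℝ] ℝ)
    (z : ℝ × 𝔼 3) : ℝ :=
  wedge₁₂ ((1 - z.1) • a₀ z.2 + z.1 • a₁ z.2) ((1 - z.1) • da₀ z.2 + z.1 • da₁ z.2)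
    (stdBasis3 0) (stdBasis3 1) (stdBasis3 2)

/-- The linear part `L((1-s)a₀ + sa₁) = (1-s)L(a₀) + sL(a₁)` on the standard frame, as a function of
`(s, p)`. [cite: Etnyre2006, proof of Prop. 3.5] -/
def ℓPart (a₀ a₁ b : 𝔼 3 → (𝔼 3) [⋀^Fin 1]→L[ℝ] ℝ) (da₀ da₁ db : 𝔼 3 → (𝔼 3) [⋀^Fin 2]→L[ℝ] ℝ)
    (z : ℝ × 𝔼 3) : ℝ :=
  (1 - z.1) * Lform (a₀ z.2) (da₀ z.2) (b z.2) (db z.2) ![stdBasis3 0, stdBasis3 1, stdBasis3 2] +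
    z.1 * Lform (a₁ z.2) (da₁ z.2) (b z.2) (db z.2) ![stdBasis3 0, stdBasis3 1, stdBasis3 2]

/-- **The expansion along the path**: with `b ∧ db = 0`,
`((1-s)a₀ + sa₁ + Rb) ∧ ((1-s)da₀ + s da₁ + R db) = qPart + R ℓPart` on the standard frame.
[cite: Etnyre2006, proof of Prop. 3.5] -/
theorem wedge₁₂_path_eq (a₀ a₁ b : 𝔼 3 → (𝔼 3) [⋀^Fin 1]→L[ℝ] ℝ)
    (da₀ da₁ db : 𝔼 3 → (𝔼 3) [⋀^Fin 2]→L[ℝ] ℝ) (R s : ℝ) (p : 𝔼 3)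
    (hbb : ∀ t, wedgeForm (b p) (db p) t = 0) :
    wedge₁₂ ((1 - s) • a₀ p + s • a₁ p + R • b p) ((1 - s) • da₀ p + s • da₁ p + R • db p)
        (stdBasis3 0) (stdBasis3 1) (stdBasis3 2) =
      qPart a₀ a₁ da₀ da₁ (s, p) + R * ℓPart a₀ a₁ b da₀ da₁ db (s, p) := by
  have hbb' : wedge₁₂ (b p) (db p) (stdBasis3 0) (stdBasis3 1) (stdBasis3 2) = 0 := by
    rw [← wedgeForm_apply]; exact hbb _
  rw [wedge₁₂_add_smul_expand, hbb', mul_zero, add_zero]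
  simp only [qPart, ℓPart, Lform_apply, wedge₁₂_add_left, wedge₁₂_add_right, wedge₁₂_smul_left,
    wedge₁₂_smul_right]
  ring

/-- Continuity of the quadratic part on `[0,1] × K`. [folklore] -/
theorem continuousOn_qPart {K : Set (𝔼 3)} {a₀ a₁ : 𝔼 3 → (𝔼 3) [⋀^Fin 1]→L[ℝ] ℝ}
    {da₀ da₁ : 𝔼 3 → (𝔼 3) [⋀^Fin 2]→L[ℝ] ℝ}
    (ha₀ : ContinuousOn a₀ K) (ha₁ : ContinuousOn a₁ K)
    (hda₀ : ContinuousOn da₀ K) (hda₁ : ContinuousOn da₁ K) (T : Set ℝ) :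
    ContinuousOn (qPart a₀ a₁ da₀ da₁) (T ×ˢ K) := by
  have hmaps : MapsTo (fun z : ℝ × 𝔼 3 => z.2) (T ×ˢ K) K := fun z hz => hz.2
  have h1 : ContinuousOn (fun z : ℝ × 𝔼 3 => a₀ z.2) (T ×ˢ K) :=
    ha₀.comp continuous_snd.continuousOn hmaps
  have h2 : ContinuousOn (fun z : ℝ × 𝔼 3 => a₁ z.2) (T ×ˢ K) :=
    ha₁.comp continuous_snd.continuousOn hmaps
  have h3 : ContinuousOn (fun z : ℝ × 𝔼 3 => da₀ z.2) (T ×ˢ K) :=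
    hda₀.comp continuous_snd.continuousOn hmaps
  have h4 : ContinuousOn (fun z : ℝ × 𝔼 3 => da₁ z.2) (T ×ˢ K) :=
    hda₁.comp continuous_snd.continuousOn hmaps
  have hs : ContinuousOn (fun z : ℝ × 𝔼 3 => 1 - z.1) (T ×ˢ K) :=
    (continuous_const.sub continuous_fst).continuousOn
  have hs' : ContinuousOn (fun z : ℝ × 𝔼 3 => z.1) (T ×ˢ K) := continuous_fst.continuousOn
  have hlin₁ : ContinuousOn (fun z : ℝ × 𝔼 3 => (1 - z.1) • a₀ z.2 + z.1 • a₁ z.2) (T ×ˢ K) :=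
    (hs.smul h1).add (hs'.smul h2)
  have hlin₂ : ContinuousOn (fun z : ℝ × 𝔼 3 => (1 - z.1) • da₀ z.2 + z.1 • da₁ z.2) (T ×ˢ K) :=
    (hs.smul h3).add (hs'.smul h4)
  exact continuousOn_wedge₁₂ hlin₁ hlin₂ _ _ _

/-- Continuity of `p ↦ L(a p)` on `K` (standard frame). [folklore] -/
theorem continuousOn_Lform_std {K : Set (𝔼 3)} {a b : 𝔼 3 → (𝔼 3) [⋀^Fin 1]→L[ℝ] ℝ}
    {da db : 𝔼 3 → (𝔼 3) [⋀^Fin 2]→L[ℝ] ℝ}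
    (ha : ContinuousOn a K) (hb : ContinuousOn b K) (hda : ContinuousOn da K)
    (hdb : ContinuousOn db K) :
    ContinuousOn (fun p => Lform (a p) (da p) (b p) (db p) ![stdBasis3 0, stdBasis3 1, stdBasis3 2])
      K := by
  simp only [Lform_apply]
  exact (continuousOn_wedge₁₂ ha hdb _ _ _).add (continuousOn_wedge₁₂ hb hda _ _ _)

/-- Continuity of the linear part on `[0,1] × K`. [folklore] -/
theorem continuousOn_ℓPart {K : Set (𝔼 3)} {a₀ a₁ b : 𝔼 3 → (𝔼 3) [⋀^Fin 1]→L[ℝ] ℝ}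
    {da₀ da₁ db : 𝔼 3 → (𝔼 3) [⋀^Fin 2]→L[ℝ] ℝ}
    (ha₀ : ContinuousOn a₀ K) (ha₁ : ContinuousOn a₁ K) (hb : ContinuousOn b K)
    (hda₀ : ContinuousOn da₀ K) (hda₁ : ContinuousOn da₁ K) (hdb : ContinuousOn db K) (T : Set ℝ) :
    ContinuousOn (ℓPart a₀ a₁ b da₀ da₁ db) (T ×ˢ K) := by
  have hmaps : MapsTo (fun z : ℝ × 𝔼 3 => z.2) (T ×ˢ K) K := fun z hz => hz.2
  have h1 : ContinuousOn (fun z : ℝ × 𝔼 3 =>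
      Lform (a₀ z.2) (da₀ z.2) (b z.2) (db z.2) ![stdBasis3 0, stdBasis3 1, stdBasis3 2]) (T ×ˢ K) :=
    (continuousOn_Lform_std ha₀ hb hda₀ hdb).comp continuous_snd.continuousOn hmaps
  have h2 : ContinuousOn (fun z : ℝ × 𝔼 3 =>
      Lform (a₁ z.2) (da₁ z.2) (b z.2) (db z.2) ![stdBasis3 0, stdBasis3 1, stdBasis3 2]) (T ×ˢ K) :=
    (continuousOn_Lform_std ha₁ hb hda₁ hdb).comp continuous_snd.continuousOn hmaps
  have hs : ContinuousOn (fun z : ℝ × 𝔼 3 => 1 - z.1) (T ×ˢ K) :=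
    (continuous_const.sub continuous_fst).continuousOn
  have hs' : ContinuousOn (fun z : ℝ × 𝔼 3 => z.1) (T ×ˢ K) := continuous_fst.continuousOn
  unfold ℓPart
  exact (hs.mul h1).add (hs'.mul h2)

/-- **The choice of `R`** (Etnyre, proof of Prop. 3.5: "for large `R` verify that `α_s` is a
contact form for all `0 ≤ s ≤ 1`").  On a compact set `K` of parameters let `a₀, a₁, b` be
continuous `1`-forms with continuous "derivatives" `da₀, da₁, db` (any `2`-forms) such that at
every point: `W(a₀) = a₀ ∧ da₀` and `W(a₁)` are positive on the same frames (same orientation),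
`L(aᵢ) = aᵢ ∧ db + b ∧ daᵢ` has the sign of `W(aᵢ)` (`i = 0, 1`), and `b ∧ db = 0`. Then there is
`R₀ > 0` such that for all `R ≥ R₀`, `s ∈ [0, 1]`, `p ∈ K`:
`((1-s)a₀ + sa₁ + Rb) ∧ ((1-s)da₀ + s da₁ + R db) ≠ 0` on the standard frame — the quadratic part
is bounded by `C` on the compact set `[0,1] × K`, the linear part `(1-s)L(a₀) + sL(a₁)` is
nonzero there (a convex combination of two quantities with the sign of `W`), hence `≥ c > 0` in
absolute value, and `R₀ = C/c + 1` works. [cite: Etnyre2006, proof of Prop. 3.5] -/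
theorem exists_R_of_isCompact {K : Set (𝔼 3)} (hK : IsCompact K)
    {a₀ a₁ b : 𝔼 3 → (𝔼 3) [⋀^Fin 1]→L[ℝ] ℝ} {da₀ da₁ db : 𝔼 3 → (𝔼 3) [⋀^Fin 2]→L[ℝ] ℝ}
    (ha₀ : ContinuousOn a₀ K) (ha₁ : ContinuousOn a₁ K) (hb : ContinuousOn b K)
    (hda₀ : ContinuousOn da₀ K) (hda₁ : ContinuousOn da₁ K) (hdb : ContinuousOn db K)
    (hor : ∀ p ∈ K, ∀ t, 0 < wedgeForm (a₀ p) (da₀ p) t ↔ 0 < wedgeForm (a₁ p) (da₁ p) t)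
    (hA₀ : ∀ p ∈ K, PosTogether (wedgeForm (a₀ p) (da₀ p)) (Lform (a₀ p) (da₀ p) (b p) (db p)))
    (hA₁ : ∀ p ∈ K, PosTogether (wedgeForm (a₁ p) (da₁ p)) (Lform (a₁ p) (da₁ p) (b p) (db p)))
    (hbb : ∀ p ∈ K, ∀ t, wedgeForm (b p) (db p) t = 0) :
    ∃ R₀ : ℝ, 0 < R₀ ∧ ∀ R, R₀ ≤ R → ∀ s ∈ Icc (0 : ℝ) 1, ∀ p ∈ K,
      wedge₁₂ ((1 - s) • a₀ p + s • a₁ p + R • b p) ((1 - s) • da₀ p + s • da₁ p + R • db p)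
        (stdBasis3 0) (stdBasis3 1) (stdBasis3 2) ≠ 0 := by
  set S : Set (ℝ × 𝔼 3) := Icc (0 : ℝ) 1 ×ˢ K with hS
  have hSc : IsCompact S := isCompact_Icc.prod hK
  have hℓne : ∀ z ∈ S, ℓPart a₀ a₁ b da₀ da₁ db z ≠ 0 := by
    rintro ⟨s, p⟩ ⟨hs, hp⟩
    obtain ⟨t₀, hW₀, hL₀⟩ := hA₀ p hp
    obtain ⟨t₁, hW₁, hL₁⟩ := hA₁ p hp
    exact convexComb_ne_zero_of_sameSign (hor p hp) hW₀ hL₀ hW₁ hL₁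
      (alt3_apply_std_ne_zero (ne_of_gt hW₀)) hs
  obtain ⟨R₀, hR₀, hR⟩ := exists_R_of_continuousOn hSc
    (continuousOn_qPart ha₀ ha₁ hda₀ hda₁ _) (continuousOn_ℓPart ha₀ ha₁ hb hda₀ hda₁ hdb _) hℓne
  refine ⟨R₀, hR₀, fun R hRR s hs p hp => ?_⟩
  rw [wedge₁₂_path_eq a₀ a₁ b da₀ da₁ db R s p (hbb p hp)]
  exact hR R hRR (s, p) ⟨hs, hp⟩

end Compact

end Literature.Geometry.Symplectic

end
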